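import Summits.AtomisticToContinuum.HydrodynamicLimit.Theorems.JaynesSqueezeHardSphereLDA
import Summits.AtomisticToContinuum.HydrodynamicLimit.Theorems.JaynesSqueezeSqueezeToBlockGibbsUniformLDA
import Summits.AtomisticToContinuum.HydrodynamicLimit.Theorems.ImplosionDichotomyHsEosLowDensity
import Mathlib.Topology.ContinuousMap.Compact
import HarnessLib

/-!
# Rate-free statics of the line `fibre-deficit-transfer` (crux `AprioriBounds`, stmt-AtomisticToContinuum-14827),
part A: the local density approximation UNIFORMLY along a continuous path of density profiles

Support file (`--supports stmt-AtomisticToContinuum-14827`) of the lead prover of the line (stub `stub_bracketVanish` of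
skeleton r4, worker file A).  The bracket `log Z_N(Λ_s) − S(μ₀) − (N+1)m_s` of the line's identity is controlled on the
whole time slab `[0, t]` through the thermodynamic limit of the tilted partition function `Z_N(Λ_s)`, which is (up to the
constant `(2π)^{3/2}e^{5/2}` per particle) the canonical partition function of the local Gibbs profile with activity
`a_s = ρ_s e^{g_σ(ρ_s)}`, `g_σ(r) = f_ex(rσ³) + rσ³ f_ex'(rσ³)`.  The LANDED static package `hardSphereLDA_proof` (B) gives,
for ONE normalised density profile in the dilute chamber, `(N+1)⁻¹ log Z_N(a_ρ) → ∫ ρ · ρσ³ f_ex'(ρσ³)`.  Here this is made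
UNIFORM in `s ∈ [0, t]` for a density path `ρ` jointly continuous on `[0,t] × 𝕋³` (`slab_uniform_lda`, registered sub-goal):
`(N+1)⁻¹ log Z_N` is `1`-Lipschitz for the sup-distance of the log-activities (`JaynesSqueezeSqueeze.abs_log_posPartition_sub_le`),
`s ↦ log a_s ∈ C(𝕋³, ℝ)` is continuous (currying of a jointly continuous map, read through the clamp onto `[0,t]`), the limit is
continuous in `s` (parametric integral), so the abstract Arzelà–Ascoli lemma
`JaynesSqueezeSqueeze.eventually_forall_abs_sub_le_of_tendsto` applies on the compact `[0, t]`.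
-/

noncomputable section

open MeasureTheory Filter Set Topology
open scoped ENNReal

namespace Summit.AtomisticToContinuum.HydrodynamicLimit.Theorems.FibreDeficitTransfer

open Literature.MathematicalPhysics.KineticTheory Literature.Analysis.FluidPDE
open Literature.Analysis.FunctionSpaces
open JaynesSqueezeSqueeze (abs_log_posPartition_sub_le eventually_forall_abs_sub_le_of_tendsto)

/-! ## The low-density equation of state in the chamber -/

/-- Under the `HsEosLowDensity` data `(η₀, F)` (`f_ex = F` on `[0, η₀)`, `F` analytic), `f_ex` and `f_ex'` are continuous on
the open chamber `(0, η₀)`. -/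
theorem bv_eos_continuousOn {η₀ : ℝ} {F : ℝ → ℝ} (hF : AnalyticOnNhd ℝ F (Ioo (-η₀) η₀))
    (hEq : EqOn hsExcessFreeEnergy F (Ico 0 η₀)) :
    ContinuousOn hsExcessFreeEnergy (Ioo 0 η₀) ∧ ContinuousOn (deriv hsExcessFreeEnergy) (Ioo 0 η₀) := by
  have hsub : Ioo (0 : ℝ) η₀ ⊆ Ioo (-η₀) η₀ := fun x hx => ⟨by linarith [hx.1, hx.2], hx.2⟩
  refine ⟨(hF.continuousOn.mono hsub).congr fun x hx => hEq ⟨hx.1.le, hx.2⟩, ?_⟩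
  refine (hF.deriv.continuousOn.mono hsub).congr fun x hx => ?_
  have hloc : hsExcessFreeEnergy =ᶠ[𝓝 x] F := by
    filter_upwards [Ioo_mem_nhds hx.1 hx.2] with y hy
    exact hEq ⟨hy.1.le, hy.2⟩
  exact hloc.deriv_eq

/-! ## The clamp onto `[0, t]` -/

/-- A field continuous on the slab `[0,t] × 𝕋³`, read through the clamp `s ↦ max 0 (min t s)` onto `[0, t]` (the tree's
`clamp_mem_Icc` / `clamp_eq_self` pattern), is globally jointly continuous. -/
theorem bv_continuous_clamp {Y : Type*} [TopologicalSpace Y] {t : ℝ} {f : ℝ → T3 → Y}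
    (hf : ContinuousOn (Function.uncurry f) (Icc 0 t ×ˢ univ)) (ht : 0 ≤ t) :
    Continuous fun p : ℝ × T3 => f (max 0 (min t p.1)) p.2 :=
  hf.comp_continuous (f := fun p : ℝ × T3 => (max 0 (min t p.1), p.2))
    ((continuous_const.max (continuous_const.min continuous_fst)).prodMk continuous_snd)
    fun _ => ⟨⟨le_max_left _ _, max_le ht (min_le_left _ _)⟩, mem_univ _⟩

/-- Slices of a field jointly continuous on the slab are continuous. -/
theorem bv_continuous_slice {Y : Type*} [TopologicalSpace Y] {t : ℝ} {f : ℝ → T3 → Y}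
    (hf : ContinuousOn (Function.uncurry f) (Icc 0 t ×ˢ univ)) {s : ℝ} (hs : s ∈ Icc 0 t) : Continuous (f s) :=
  hf.comp_continuous (f := fun x : T3 => (s, x)) (continuous_const.prodMk continuous_id) fun x => ⟨hs, mem_univ x⟩

/-! ## The uniform local density approximation on the slab -/

/-- **Uniform LDA along a continuous density path** (registered sub-goal `slab_uniform_lda`).  There is a chamber threshold
`η₁ > 0` (the minimum of the `HsEosLowDensity` and `HardSphereLDA` thresholds) such that for `0 < σ ≤ 1/2`, `t ≥ 0`, a density
path `ρ` jointly continuous on `[0,t] × 𝕋³` with `c ≤ ρ`, `ρσ³ < η₁` and unit mass at every `s ≤ t`, and slice-wise continuous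
velocity / positive temperature profiles, the local density approximation of the canonical partition function at the activity
`ρ_s e^{g_σ(ρ_s)}` holds UNIFORMLY in `s ∈ [0, t]`:
`sup_{s ≤ t} |(N+1)⁻¹ log Z_N(s) − ∫ ρ_s · ρ_sσ³ f_ex'(ρ_sσ³)| → 0`. -/
theorem slab_uniform_lda : ∃ η₁ : ℝ, 0 < η₁ ∧ ∀ (σ t c : ℝ) (ρ θ : ℝ → T3 → ℝ) (u : ℝ → T3 → V3) (Φ : (N : ℕ) → HardSphereFlow (Torus.geometry (Fin 3)) (hsDiameter σ N) (N + 1)), 0 < σ → σ ≤ 1 / 2 → 0 ≤ t → 0 < c → ContinuousOn (Function.uncurry ρ) (Icc 0 t ×ˢ univ) → (∀ s ∈ Icc 0 t, Continuous (θ s) ∧ Continuous (u s) ∧ ∀ x, 0 < θ s x) → (∀ s ∈ Icc 0 t, ∀ x, c ≤ ρ s x ∧ ρ s x * σ ^ 3 < η₁) → (∀ s ∈ Icc 0 t, ∫ x, ρ s x = 1) → ∀ ε : ℝ, 0 < ε → ∀ᶠ N : ℕ in atTop, ∀ s ∈ Icc 0 t, |((N : ℝ) + 1)⁻¹ * Real.log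 (canonicalPartition (Torus.geometry (Fin 3)) (hsDiameter σ N) (N + 1) (localGibbsProfile (fun x => ρ s x * Real.exp (hsExcessFreeEnergy (ρ s x * σ ^ 3) + ρ s x * σ ^ 3 * deriv hsExcessFreeEnergy (ρ s x * σ ^ 3))) (u s) (θ s))) - ∫ x, ρ s x * (ρ s x * σ ^ 3 * deriv hsExcessFreeEnergy (ρ s x * σ ^ 3))| ≤ ε := by
  obtain ⟨η₀, hη₀, F, hF, hEq, -, -, -⟩ := hsEosLowDensity_proof
  obtain ⟨η₁, hη₁, hLDA⟩ := hardSphereLDA_proof Theses.JaynesSqueeze.HsEosLowDensity_holds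
  obtain ⟨hfc, hdfc⟩ := bv_eos_continuousOn hF hEq
  refine ⟨min η₀ η₁, lt_min hη₀ hη₁, ?_⟩
  intro σ t c ρ θ u Φ hσ hσ2 ht hc hρc hsl hch hmass ε hε
  have hσ3 : 0 < σ ^ 3 := pow_pos hσ 3
  -- the clamp onto `[0, t]`
  have hclmem : ∀ s : ℝ, max 0 (min t s) ∈ Icc 0 t := fun s => ⟨le_max_left _ _, max_le ht (min_le_left _ _)⟩
  have hcleq : ∀ s ∈ Icc 0 t, max 0 (min t s) = s := fun s hs => by rw [min_eq_right hs.2, max_eq_right hs.1]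
  -- the equation-of-state functions at this `σ`
  set g : ℝ → ℝ := fun r => hsExcessFreeEnergy (r * σ ^ 3) + r * σ ^ 3 * deriv hsExcessFreeEnergy (r * σ ^ 3) with hg
  set ψ : ℝ → ℝ := fun r => r * σ ^ 3 * deriv hsExcessFreeEnergy (r * σ ^ 3) with hψ
  have hψr : ∀ r, r * σ ^ 3 * deriv hsExcessFreeEnergy (r * σ ^ 3) = ψ r := fun r => rfl
  have hgψr : ∀ r, hsExcessFreeEnergy (r * σ ^ 3) + ψ r = g r := fun r => rfl
  simp only [hψr, hgψr]
  -- the chamber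
  have hρpos : ∀ s ∈ Icc 0 t, ∀ x, 0 < ρ s x := fun s hs x => hc.trans_le (hch s hs x).1
  have hch₁ : ∀ s ∈ Icc 0 t, ∀ x, c ≤ ρ s x ∧ ρ s x * σ ^ 3 ≤ η₁ := fun s hs x =>
    ⟨(hch s hs x).1, ((hch s hs x).2.trans_le (min_le_right _ _)).le⟩
  have hJ : ∀ r ∈ Ioo (0 : ℝ) (η₀ / σ ^ 3), r * σ ^ 3 ∈ Ioo 0 η₀ := fun r hr =>
    ⟨mul_pos hr.1 hσ3, (lt_div_iff₀ hσ3).1 hr.2⟩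
  have hlin : ContinuousOn (fun r : ℝ => r * σ ^ 3) (Ioo 0 (η₀ / σ ^ 3)) := continuousOn_id.mul continuousOn_const
  have hψc : ContinuousOn ψ (Ioo 0 (η₀ / σ ^ 3)) := hlin.mul (hdfc.comp hlin hJ)
  have hgc : ContinuousOn g (Ioo 0 (η₀ / σ ^ 3)) := (hfc.comp hlin hJ).add hψc
  have hρJ : ∀ s ∈ Icc 0 t, ∀ x, ρ s x ∈ Ioo (0 : ℝ) (η₀ / σ ^ 3) := fun s hs x =>
    ⟨hρpos s hs x, (lt_div_iff₀ hσ3).2 ((hch s hs x).2.trans_le (min_le_left _ _))⟩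
  -- the clamped density path: globally jointly continuous, with values in the chamber
  set ρc : ℝ → T3 → ℝ := fun s x => ρ (max 0 (min t s)) x with hρc_def
  have hρcc : Continuous (Function.uncurry ρc) := bv_continuous_clamp hρc ht
  have hρcc' : Continuous fun p : ℝ × T3 => ρc p.1 p.2 := hρcc
  have hρcmem : ∀ s x, ρc s x ∈ Ioo (0 : ℝ) (η₀ / σ ^ 3) := fun s x => hρJ _ (hclmem s) x
  have hρc_eq : ∀ s ∈ Icc 0 t, ∀ x, ρc s x = ρ s x := fun s hs x => by
    simp only [hρc_def, hcleq s hs]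
  -- the activity path and its logarithm as a continuous curve in `C(𝕋³, ℝ)`
  set b : ℝ → T3 → ℝ := fun s x => ρc s x * Real.exp (g (ρc s x)) with hb_def
  have hbpos : ∀ s x, 0 < b s x := fun s x => mul_pos (hρcmem s x).1 (Real.exp_pos _)
  have hbc : Continuous fun p : ℝ × T3 => b p.1 p.2 :=
    hρcc'.mul ((hgc.comp_continuous hρcc' fun p => hρcmem p.1 p.2).rexp)
  have hbsc : ∀ s, Continuous (b s) := fun s => hbc.comp (continuous_const.prodMk continuous_id)
  have hbm : ∀ s, Measurable (b s) := fun s => (hbsc s).measurable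
  have hlogb : Continuous fun p : ℝ × T3 => Real.log (b p.1 p.2) := hbc.log fun p => (hbpos p.1 p.2).ne'
  set Lf : C(ℝ × T3, ℝ) := ⟨fun p => Real.log (b p.1 p.2), hlogb⟩ with hLf
  set L : ℝ → C(T3, ℝ) := fun s => Lf.curry s with hL
  have hLc : Continuous L := Lf.curry.continuous
  have hLapply : ∀ s x, L s x = Real.log (b s x) := fun s x => rfl
  -- a uniform upper bound of the activity on the slab
  obtain ⟨B, hB⟩ := ((isCompact_Icc (a := (0 : ℝ)) (b := t)).prod (isCompact_univ (X := T3))).exists_bound_of_continuousOn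
    hbc.continuousOn
  have hbB : ∀ s ∈ Icc 0 t, ∀ x, b s x ≤ B := fun s hs x => by
    have h := hB (s, x) ⟨hs, mem_univ x⟩
    rw [Real.norm_eq_abs] at h
    exact (le_abs_self _).trans h
  have hZpos : ∀ (N : ℕ) (s : ℝ), 0 < posPartition (b s) (hsDiameter σ N) (N + 1) := fun N s =>
    posPartition_pos (hbsc s) (hbpos s) hσ2 N
  -- the sequence and its limit
  set f : ℕ → ℝ → ℝ := fun N s => ((N : ℝ) + 1)⁻¹ * Real.log (posPartition (b s) (hsDiameter σ N) (N + 1)) with hf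
  set G : ℝ → ℝ := fun s => ∫ x, ρc s x * ψ (ρc s x) with hG
  have hGc : Continuous G := by
    have hFc : Continuous (Function.uncurry fun (s : ℝ) (x : T3) => ρc s x * ψ (ρc s x)) :=
      hρcc'.mul (hψc.comp_continuous hρcc' fun p => hρcmem p.1 p.2)
    have h := continuous_parametric_integral_of_continuous (μ := (volume : Measure T3)) hFc isCompact_univ
    simp only [Measure.restrict_univ] at h
    exact h
  -- on the slab the activity path is the genuine one
  have hbs : ∀ s ∈ Icc 0 t, b s = fun x => ρ s x * Real.exp (g (ρ s x)) := fun s hs => by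
    funext x
    simp only [hb_def, hρc_eq s hs x]
  have hZeq : ∀ (N : ℕ), ∀ s ∈ Icc 0 t, canonicalPartition (Torus.geometry (Fin 3)) (hsDiameter σ N) (N + 1)
      (localGibbsProfile (fun x => ρ s x * Real.exp (g (ρ s x))) (u s) (θ s)) = posPartition (b s) (hsDiameter σ N) (N + 1) := by
    intro N s hs
    obtain ⟨hθs, hus, hθpos⟩ := hsl s hs
    rw [← hbs s hs]
    exact canonicalPartition_eq_posPartition (hbsc s) hθs hus (fun x => (hbpos s x).le) hθpos _ _
  -- pointwise convergence on the slab: `HardSphereLDA` (B)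
  have hpt : ∀ s ∈ Icc 0 t, Tendsto (fun N => f N s) atTop (𝓝 (G s)) := by
    intro s hs
    obtain ⟨hθs, hus, hθpos⟩ := hsl s hs
    obtain ⟨-, hBσ⟩ := hLDA σ hσ
    obtain ⟨hZ, -, -⟩ := hBσ c hc (ρ s) (bv_continuous_slice hρc hs).measurable (hch₁ s hs) (hmass s hs) (u s) (θ s)
      hus.measurable hθs.measurable hθpos Φ
    simp only [hψr, hgψr] at hZ
    have hGs : G s = ∫ x, ρ s x * ψ (ρ s x) := by simp only [hG, hρc_eq s hs]
    rw [hGs]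
    refine hZ.congr fun N => ?_
    simp only [hf, hZeq N s hs]
  -- equi-Lipschitz dependence on `s` through the curve `L`
  have hlip : ∀ N : ℕ, ∀ s₁ ∈ Icc 0 t, ∀ s₂ ∈ Icc 0 t, |f N s₁ - f N s₂| ≤ dist (L s₁) (L s₂) := by
    intro N s₁ hs₁ s₂ hs₂
    have hD : ∀ x, |Real.log (b s₁ x) - Real.log (b s₂ x)| ≤ dist (L s₁) (L s₂) := fun x => by
      rw [← Real.dist_eq, ← hLapply s₁ x, ← hLapply s₂ x]
      exact ContinuousMap.dist_apply_le_dist x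
    have h := abs_log_posPartition_sub_le (hbm s₁) (hbm s₂) (hbpos s₁) (hbpos s₂) (hbB s₁ hs₁) (hbB s₂ hs₂) hD
      (hsDiameter σ N) (N + 1) (hZpos N s₁) (hZpos N s₂)
    have hNpos : (0 : ℝ) < ((N : ℝ) + 1)⁻¹ := by positivity
    simp only [hf]
    rw [← mul_sub, abs_mul, abs_of_pos hNpos]
    calc ((N : ℝ) + 1)⁻¹ * |Real.log (posPartition (b s₁) (hsDiameter σ N) (N + 1)) -
          Real.log (posPartition (b s₂) (hsDiameter σ N) (N + 1))|
        ≤ ((N : ℝ) + 1)⁻¹ * (((N + 1 : ℕ) : ℝ) * dist (L s₁) (L s₂)) := by gcongr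
      _ = dist (L s₁) (L s₂) := by push_cast; field_simp
  -- uniform convergence on the compact slab
  have hunif := eventually_forall_abs_sub_le_of_tendsto isCompact_Icc hGc.continuousOn hLc.continuousOn hlip hpt hε
  filter_upwards [hunif] with N hN s hs
  have hGs : G s = ∫ x, ρ s x * ψ (ρ s x) := by simp only [hG, hρc_eq s hs]
  have h := hN s hs
  rw [hGs] at h
  simpa only [hf, hZeq N s hs] using h

end Summit.AtomisticToContinuum.HydrodynamicLimit.Theorems.FibreDeficitTransfer

end
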